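import Literature.NumberTheory.Transcendental.WeakZPCompactness
import Literature.NumberTheory.Transcendental.GammaLocusSlices
import Literature.NumberTheory.Transcendental.WeakCITLattice
import HarnessLib

/-!
# Horizontal weak Zilber–Pink, step 5: the basic uniform statement relative to an ambient
subtorus

Support file for the uniform horizontal weak Zilber–Pink theorem (Bays–Kirby 2018, Thm 11.4 /
Fact 11.3 = Kirby 2009, Thm 4.6; Zilber 2002), in the service of the named fact
`Literature.NumberTheory.Transcendental.BaysKirby2018_prop_11_5` and of Bays–Kirby's Thm 1.5
(`Literature.NumberTheory.Transcendental.isQuasiminimal_of_isExpAlgClosed`).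

**Statement** (`WeakZP.weakZP_basic_rel`, the "basic" weak Zilber–Pink / uniform weak CIT for a
polynomial family, relative to a fixed connected subgroup `H` of `𝔾ₘ^m`, horizontal in the vector
group). Let `(V_b)_{b ∈ ℂ^p}` be a polynomial family of subvarieties of `𝔾ₐ^{N'} × 𝔾ₘ^m`
(`WeakZP.famV Φ b`, `Φ ⊆ ℂ[b, u, y]` finite) all of whose members lie in cosets `𝔾ₐ^{N'} × c·H`
of a fixed subtorus `H = H_{L_H}` (`L_H ≤ ℚ^m` a rational subspace, `dim H = m - dim L_H`; the
condition is `WeakZP.InCoset (V_b) L_H`: all characters `y^ν`, `ν ∈ ℤ^m ∩ L_H`, are constant on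
`V_b`). Then there is a finite set `𝓠` of integer vectors `q ∉ L_H` (characters not killing `H`)
such that: for every `b`, every subtorus `J = H_{L_J}`, and every irreducible `X ⊆ V_b` lying in a
coset of `J` (`X ≠ ∅` in the torus part, `I(X)` prime) which is **atypical relative to `H`**,
`dim X > dim V_b + dim (H ∩ J)° - dim H`, some `q ∈ 𝓠` has `y^ν` constant on `X` for every
`ν ∈ ℤ^m ∩ (L_H + ℚq)`, i.e. `X` lies in a coset of the codimension-one subtorus
`(H ∩ ker y^q)°` of `H`. This is the horizontal (`U = 𝔾ₐ^{N'}`), toric (`S = 𝔾ₘ^m`) case of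
Bays–Kirby's Thm 11.4 relative to `H` without the clause `(*)`, which is obtained from it by an
induction on `dim H` in `WeakZPStar.lean`.

**Proof** (Zilber 2002 / Kirby 2009, Thm 4.6, made uniform by compactness as in Kirby's Thm 4.3;
here via ultraproducts). Suppose not; then for every `k` there is a bad situation
`(b_k, J_k, X_k)` for the finite set `𝓠_k = {q : |qₗ| ≤ k, q ∉ L_H}`. By pigeonhole we may assume
`dim V_{b_k} = d₀` is constant. Take two-block logarithmic points `L_k` of the `X_k`
(`WeakZP.exists_logPointG_of_isPrime`), a unimodular basis adapted to the pure lattice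
`ℤ^m ∩ L_H` (`WeakCIT.exists_unimodular`; `|I_H| = dim L_H`) and, for each `k`, one adapted to
`ℤ^m ∩ (L_H + L_{J_k})`. The characters constant on `X_k` are exactly the integer points of the
*annihilator subspace* `ann(L_k) = {v | D_j (Σ vₗ xₗ) = 0 ∀ j}` (`WeakZP.LogPointG.ann`; generic
point transfer), so `L_H + L_{J_k} ≤ ann(L_k)`; the components of `V_{b_k}` through `X_k` have
dimension `≤ d₀`; and atypicality reads `d₀ + |I_H| < |S_y| + |S_u| + |J_k|`. The compactness
step `WeakZP.exists_int_relation_of_familyG` yields a *standard* integer vector `q = rᵀ U_H`,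
`r ≠ 0` off `I_H` (so `q ∉ L_H`, the rows of `U_H` being a `ℤ`-basis), with `y_k^q` killed by all
derivations of `L_k` for infinitely many `k`; for such `k ≥ max |qₗ|`, `q ∈ 𝓠_k` and
`L_H + ℚq ≤ ann(L_k)`, contradicting badness.

## References

* J. Kirby, *The theory of the exponential differential equations of semiabelian varieties*,
  Selecta Math. 15 (2009), Thm 4.3, Thm 4.6.
* B. Zilber, *Exponential sums equations and the Schanuel conjecture*, J. LMS 65 (2002), Cor. 3.
* M. Bays, J. Kirby, *Pseudo-exponential maps, variants, and quasiminimality*, ANT 12 (2018),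
  §2.2, Fact 11.3, Thm 11.4.
-/

noncomputable section

open MvPolynomial Set

namespace Literature.NumberTheory.Transcendental.WeakZP

/-! ### Rational subspaces of `ℚ^m` and their integer points -/

section Lattice

variable {m : ℕ}

/-- An integer vector regarded as a rational vector. [folklore] -/
def qv (ν : Fin m → ℤ) : Fin m → ℚ := fun l => (ν l : ℚ)

/-- Coordinates of `qv ν`. [folklore] -/
@[simp] theorem qv_apply (ν : Fin m → ℤ) (l : Fin m) : qv ν l = (ν l : ℚ) := rfl

/-- `qv 0 = 0`. [folklore] -/
@[simp] theorem qv_zero : qv (0 : Fin m → ℤ) = 0 := by funext l; simp [qv]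

/-- `qv` is additive. [folklore] -/
@[simp] theorem qv_add (ν μ : Fin m → ℤ) : qv (ν + μ) = qv ν + qv μ := by
  funext l; simp [qv]

/-- `qv (-ν) = -qv ν`. [folklore] -/
@[simp] theorem qv_neg (ν : Fin m → ℤ) : qv (-ν) = -qv ν := by funext l; simp [qv]

/-- `qv` respects subtraction. [folklore] -/
@[simp] theorem qv_sub (ν μ : Fin m → ℤ) : qv (ν - μ) = qv ν - qv μ := by
  funext l; simp [qv]

/-- `qv (n • ν) = n • qv ν` for integers. [folklore] -/
@[simp] theorem qv_zsmul (n : ℤ) (ν : Fin m → ℤ) : qv (n • ν) = (n : ℚ) • qv ν := by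
  funext l; simp [qv]

/-- `qv (n • ν) = n • qv ν` for naturals. [folklore] -/
@[simp] theorem qv_nsmul (n : ℕ) (ν : Fin m → ℤ) : qv (n • ν) = (n : ℚ) • qv ν := by
  funext l; simp [qv]

/-- `qv` is injective. [folklore] -/
theorem qv_injective : Function.Injective (qv (m := m)) := fun ν μ h => by
  funext l; have := congrFun h l; simpa [qv] using this

/-- `qv` as an additive monoid homomorphism. [folklore] -/
def qvHom : (Fin m → ℤ) →+ (Fin m → ℚ) where
  toFun := qv
  map_zero' := qv_zero
  map_add' := qv_add

/-- `qvHom` is `qv`. [folklore] -/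
@[simp] theorem qvHom_apply (ν : Fin m → ℤ) : qvHom ν = qv ν := rfl

/-- `qv` of a sum. [folklore] -/
theorem qv_sum {ι : Type*} (s : Finset ι) (f : ι → Fin m → ℤ) :
    qv (∑ i ∈ s, f i) = ∑ i ∈ s, qv (f i) :=
  map_sum (qvHom (m := m)) f s

/-- The integer points `ℤ^m ∩ L` of a rational subspace `L ≤ ℚ^m`: the (pure) lattice of the
subtorus `H_L`. [cite: BaysKirby2018ANT, §2.2] -/
def latt (L : Submodule ℚ (Fin m → ℚ)) : AddSubgroup (Fin m → ℤ) :=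
  L.toAddSubgroup.comap qvHom

/-- Membership in `latt L`. [folklore] -/
@[simp] theorem mem_latt_iff {L : Submodule ℚ (Fin m → ℚ)} {ν : Fin m → ℤ} :
    ν ∈ latt L ↔ qv ν ∈ L := Iff.rfl

/-- `ℤ^m ∩ L` is a pure subgroup. [folklore] -/
theorem nsmulSaturated_latt (L : Submodule ℚ (Fin m → ℚ)) :
    (latt L).toAddSubmonoid.NSMulSaturated := by
  intro n ν hν
  by_cases hn : n = 0
  · exact Or.inl hn
  · right
    have hν' : (n : ℚ) • qv ν ∈ L := by
      have : qv (n • ν) ∈ L := hν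
      rwa [qv_nsmul] at this
    have hn' : (n : ℚ) ≠ 0 := Nat.cast_ne_zero.mpr hn
    have := L.smul_mem (n : ℚ)⁻¹ hν'
    rwa [inv_smul_smul₀ hn'] at this

/-- Every rational vector has a non-zero integer multiple which is an integer vector. [folklore] -/
theorem exists_int_smul_eq_qv (v : Fin m → ℚ) :
    ∃ d : ℤ, d ≠ 0 ∧ ∃ ν : Fin m → ℤ, qv ν = (d : ℚ) • v := by
  refine ⟨∏ l, ((v l).den : ℤ), ?_, fun l => ((∏ l' ∈ Finset.univ.erase l, ((v l').den : ℤ)) * (v l).num), ?_⟩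
  · exact Finset.prod_ne_zero_iff.mpr fun l _ => Int.natCast_ne_zero.mpr (v l).den_nz
  · funext l
    simp only [qv_apply, Pi.smul_apply, smul_eq_mul]
    rw [← Finset.prod_erase_mul _ _ (Finset.mem_univ l)]
    push_cast
    rw [mul_assoc, Rat.den_mul_eq_num]
    
/-- A rational subspace is determined by its integer points. [folklore] -/
theorem le_of_forall_qv_mem {L A : Submodule ℚ (Fin m → ℚ)}
    (h : ∀ ν : Fin m → ℤ, qv ν ∈ L → qv ν ∈ A) : L ≤ A := by
  intro v hv
  obtain ⟨d, hd, ν, hν⟩ := exists_int_smul_eq_qv v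
  have hνL : qv ν ∈ L := by rw [hν]; exact L.smul_mem _ hv
  have := A.smul_mem (d : ℚ)⁻¹ (h ν hνL)
  rwa [hν, inv_smul_smul₀ (Int.cast_ne_zero.mpr hd)] at this

/-- The integer points of a rational subspace span it. [folklore] -/
theorem span_qv_image_latt (L : Submodule ℚ (Fin m → ℚ)) :
    Submodule.span ℚ (qv '' (latt L : Set (Fin m → ℤ))) = L := by
  refine le_antisymm (Submodule.span_le.mpr ?_) (le_of_forall_qv_mem fun ν hν => ?_)
  · rintro _ ⟨ν, hν, rfl⟩; exact hν
  · exact Submodule.subset_span ⟨ν, hν, rfl⟩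

/-- **Rank of a pure lattice with a unimodular adapted basis.** If the rows `U_i`, `i ∈ I`, of
an integer unimodular matrix generate `ℤ^m ∩ L`, then `|I| = dim_ℚ L`. [folklore] -/
theorem card_eq_finrank_of_unimodular {L : Submodule ℚ (Fin m → ℚ)} {U U' : Matrix (Fin m) (Fin m) ℤ}
    (hUU' : U * U' = 1) {I : Finset (Fin m)}
    (hgen : latt L = AddSubgroup.closure ((fun i => U i) '' (I : Set (Fin m)))) :
    I.card = Module.finrank ℚ L := by
  classical
  -- the rows `qv (U i)`, `i ∈ I`, are linearly independent and span `L`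
  have hUinv : IsUnit (U.map (Int.cast : ℤ → ℚ)).det := by
    refine Matrix.isUnit_det_of_right_inverse (B := U'.map (Int.cast : ℤ → ℚ)) ?_
    rw [show (Int.cast : ℤ → ℚ) = ⇑(Int.castRingHom ℚ) from (Int.coe_castRingHom (α := ℚ)).symm,
      ← Matrix.map_mul, hUU', Matrix.map_one _ (map_zero _) (map_one _)]
  have hli : LinearIndependent ℚ (U.map (Int.cast : ℤ → ℚ)).row :=
    Matrix.linearIndependent_rows_iff_isUnit.2 ((Matrix.isUnit_iff_isUnit_det _).2 hUinv)
  have hrow : (U.map (Int.cast : ℤ → ℚ)).row = fun i => qv (U i) := rfl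
  rw [hrow] at hli
  have hli' : LinearIndependent ℚ (fun i : (I : Set (Fin m)) => qv (U (i : Fin m))) :=
    hli.comp (fun i : (I : Set (Fin m)) => (i : Fin m)) Subtype.val_injective
  have hspan : Submodule.span ℚ (Set.range fun i : (I : Set (Fin m)) => qv (U (i : Fin m))) = L := by
    have hr : Set.range (fun i : (I : Set (Fin m)) => qv (U (i : Fin m))) =
        qv '' ((fun i => U i) '' (I : Set (Fin m))) := by
      ext v
      simp only [Set.mem_range, Set.mem_image, Subtype.exists, Finset.mem_coe, exists_prop]
      constructor
      · rintro ⟨i, hi, rfl⟩; exact ⟨U i, ⟨i, hi, rfl⟩, rfl⟩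
      · rintro ⟨_, ⟨i, hi, rfl⟩, rfl⟩; exact ⟨i, hi, rfl⟩
    rw [hr]
    refine le_antisymm (Submodule.span_le.mpr ?_) (le_of_forall_qv_mem fun ν hν => ?_)
    · rintro _ ⟨μ, hμ, rfl⟩
      have : μ ∈ latt L := by rw [hgen]; exact AddSubgroup.subset_closure hμ
      exact this
    · have hν' : ν ∈ AddSubgroup.closure ((fun i => U i) '' (I : Set (Fin m))) := by
        rw [← hgen]; exact hν
      refine AddSubgroup.closure_induction (p := fun μ _ => qv μ ∈ Submodule.span ℚ (qv '' ((fun i => U i) '' (I : Set (Fin m))))) ?_ ?_ ?_ ?_ hν'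
      · intro μ hμ; exact Submodule.subset_span ⟨μ, hμ, rfl⟩
      · simp
      · intro a b _ _ ha hb; rw [qv_add]; exact Submodule.add_mem _ ha hb
      · intro a _ ha; rw [qv_neg]; exact Submodule.neg_mem _ ha
  rw [← hspan, finrank_span_eq_card hli']
  simp

/-- `dim_ℚ L ≤ m`. [folklore] -/
theorem finrank_le_m (L : Submodule ℚ (Fin m → ℚ)) : Module.finrank ℚ L ≤ m := by
  have := Submodule.finrank_le L
  simpa using this

end Lattice

/-! ### Monomials constant on `X` and the annihilator subspace of a logarithmic point -/

section Ann

variable {N' m : ℕ}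

/-- On the torus part of any field `E ⊇ ℂ`, `∏ v₂ₗ^{νₗ} = c` (`ν ∈ ℤ^m`, `c ∈ ℂ`) is the polynomial
equation `∏ Y_l^{νₗ⁺} = c ∏ Y_l^{νₗ⁻}`. [folklore] -/
theorem aeval_binomial₂_eq_zero_iff {E : Type*} [Field E] [Algebra ℂ E] {v : Fin N' ⊕ Fin m → E}
    (hv : ∀ l, v (Sum.inr l) ≠ 0) (ν : Fin m → ℤ) (c : ℂ) :
    aeval v ((∏ l, X (Sum.inr l) ^ (ν l).toNat) - C c * ∏ l, X (Sum.inr l) ^ (-ν l).toNat :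
      MvPolynomial (Fin N' ⊕ Fin m) ℂ) = 0 ↔ ∏ l, v (Sum.inr l) ^ ν l = algebraMap ℂ E c := by
  have hne : (∏ l, v (Sum.inr l) ^ (-ν l).toNat) ≠ 0 :=
    Finset.prod_ne_zero_iff.mpr fun l _ => pow_ne_zero _ (hv l)
  have hprod : ∏ l, v (Sum.inr l) ^ ν l =
      (∏ l, v (Sum.inr l) ^ (ν l).toNat) / ∏ l, v (Sum.inr l) ^ (-ν l).toNat := by
    rw [← Finset.prod_div_distrib]
    refine Finset.prod_congr rfl fun l _ => ?_
    rw [← zpow_natCast, ← zpow_natCast, ← zpow_sub₀ (hv l), Int.toNat_sub_toNat_neg]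
  simp only [map_sub, map_mul, map_prod, map_pow, aeval_X, aeval_C]
  rw [sub_eq_zero, hprod, div_eq_iff hne]

/-- The ratio form: `∏ (zₗ/wₗ)^{νₗ} = (∏ zₗ^{νₗ}) / ∏ wₗ^{νₗ}`. [folklore] -/
theorem prod_div_zpow {E : Type*} [Field E] (z w : Fin m → E) (ν : Fin m → ℤ) :
    ∏ l, (z l / w l) ^ ν l = (∏ l, z l ^ ν l) / ∏ l, w l ^ ν l := by
  rw [← Finset.prod_div_distrib]
  exact Finset.prod_congr rfl fun l _ => div_zpow _ _ _

namespace LogPointG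

variable (L : LogPointG N' m)

/-- The **annihilator subspace** of a logarithmic point: the rational vectors `v` with
`D_j (Σ vₗ xₗ) = 0` for all `j`, i.e. the characters `y^v` (for `v` integral) constant at the
generic point. [cite: Kirby2009, Thm 4.6 (proof)] -/
def ann : Submodule ℚ (Fin m → ℚ) where
  carrier := {v | ∀ j, L.D j (∑ l, ((v l : ℚ) : L.F) * L.x l) = 0}
  zero_mem' j := by simp
  add_mem' {a b} ha hb j := by
    have : ∑ l, (((a + b) l : ℚ) : L.F) * L.x l =
        (∑ l, ((a l : ℚ) : L.F) * L.x l) + ∑ l, ((b l : ℚ) : L.F) * L.x l := by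
      rw [← Finset.sum_add_distrib]
      refine Finset.sum_congr rfl fun l _ => ?_
      rw [Pi.add_apply, Rat.cast_add, add_mul]
    rw [this, map_add, ha j, hb j, add_zero]
  smul_mem' c a ha j := by
    have : ∑ l, (((c • a) l : ℚ) : L.F) * L.x l = ((c : ℚ) : L.F) * ∑ l, ((a l : ℚ) : L.F) * L.x l := by
      rw [Finset.mul_sum]
      refine Finset.sum_congr rfl fun l _ => ?_
      rw [Pi.smul_apply, smul_eq_mul, Rat.cast_mul, mul_assoc]
    have hc : L.D j ((c : ℚ) : L.F) = 0 := by
      rw [← map_ratCast (algebraMap ℂ L.F) c]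
      exact Derivation.map_algebraMap _ _
    rw [this, Derivation.leibniz, hc, smul_zero, add_zero, ha j, smul_zero]

/-- Membership in the annihilator subspace. [folklore] -/
theorem mem_ann_iff {v : Fin m → ℚ} : v ∈ L.ann ↔ ∀ j, L.D j (∑ l, ((v l : ℚ) : L.F) * L.x l) = 0 :=
  Iff.rfl

/-- Integer vectors in the annihilator. [folklore] -/
theorem qv_mem_ann_iff {ν : Fin m → ℤ} :
    qv ν ∈ L.ann ↔ ∀ j, L.D j (∑ l, (ν l : L.F) * L.x l) = 0 := by
  simp only [mem_ann_iff, qv_apply, Rat.cast_intCast]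

/-- `D_j (y^ν) = y^ν · D_j (Σ νₗ xₗ)`. [folklore] -/
theorem D_prod_zpow (j : Fin (N' + m)) (ν : Fin m → ℤ) :
    L.D j (∏ l, L.y l ^ ν l) = (∏ l, L.y l ^ ν l) * L.D j (∑ l, (ν l : L.F) * L.x l) := by
  have h := derivation_prod_zpow ((L.D j).restrictScalars ℤ) L.x L.y L.y_ne_zero
    (fun l => L.map_y j l) ν
  exact h

/-- `qv ν ∈ ann` iff all `D_j` kill the monomial `y^ν`. [folklore] -/
theorem qv_mem_ann_iff_prod {ν : Fin m → ℤ} :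
    qv ν ∈ L.ann ↔ ∀ j, L.D j (∏ l, L.y l ^ ν l) = 0 := by
  rw [qv_mem_ann_iff]
  have hP : (∏ l, L.y l ^ ν l) ≠ 0 :=
    Finset.prod_ne_zero_iff.mpr fun l _ => zpow_ne_zero _ (L.y_ne_zero l)
  refine forall_congr' fun j => ?_
  rw [D_prod_zpow, mul_eq_zero, or_iff_right hP]

variable {L}
variable {X : Set (Fin N' ⊕ Fin m → ℂ)}

/-- **Constant characters give trivial ratios.** If `qv ν ∈ ann(L)` for a logarithmic point `L`
of `X` (`L.P = I(X)`), then `y^ν` is a complex constant at the generic point, hence constant on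
`X`: `∏ (zₗ/wₗ)^{νₗ} = 1` for `z, w ∈ X`. [cite: Kirby2009, Thm 4.6 (proof)] -/
theorem ratio_eq_one_of_qv_mem_ann (hX : X ⊆ torus₂ N' m) (hP : L.P = vanishingIdeal ℂ X)
    {ν : Fin m → ℤ} (hν : qv ν ∈ L.ann) {z w : Fin N' ⊕ Fin m → ℂ} (hz : z ∈ X) (hw : w ∈ X) :
    ∏ l, (z (Sum.inr l) / w (Sum.inr l)) ^ ν l = 1 := by
  obtain ⟨c, hc⟩ := L.exists_eq_algebraMap ν ((qv_mem_ann_iff_prod L).1 hν)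
  -- the binomial lies in `P = I(X)`
  have hmem : ((∏ l, MvPolynomial.X (Sum.inr l) ^ (ν l).toNat) -
      C c * ∏ l, MvPolynomial.X (Sum.inr l) ^ (-ν l).toNat : MvPolynomial (Fin N' ⊕ Fin m) ℂ) ∈ L.P := by
    rw [← L.aeval_eq_zero_iff]
    exact (aeval_binomial₂_eq_zero_iff (v := Sum.elim L.u L.y) L.y_ne_zero ν c).2 hc
  rw [hP] at hmem
  have hval : ∀ z ∈ X, ∏ l, z (Sum.inr l) ^ ν l = c := fun z hz => by
    have h := (mem_vanishingIdeal_iff.1 hmem) z hz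
    rw [aeval_binomial₂_eq_zero_iff (fun l => hX hz l) ν c, Algebra.algebraMap_self_apply] at h
    exact h
  have hc0 : c ≠ 0 := by
    rw [← hval z hz]
    exact Finset.prod_ne_zero_iff.mpr fun l _ => zpow_ne_zero _ (hX hz l)
  rw [prod_div_zpow (fun l => z (Sum.inr l)) (fun l => w (Sum.inr l)) ν, hval z hz, hval w hw,
    div_self hc0]

/-- **Trivial ratios give constant characters.** If `∏ (zₗ/wₗ)^{νₗ} = 1` for all `z, w ∈ X`
(`X ≠ ∅` in the torus part), then `qv ν ∈ ann(L)` for every logarithmic point `L` of `X`.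
[cite: Kirby2009, Thm 4.6 (proof)] -/
theorem qv_mem_ann_of_ratio_eq_one (hX : X ⊆ torus₂ N' m) (hP : L.P = vanishingIdeal ℂ X)
    (hne : X.Nonempty) {ν : Fin m → ℤ}
    (h : ∀ z ∈ X, ∀ w ∈ X, ∏ l, (z (Sum.inr l) / w (Sum.inr l)) ^ ν l = 1) : qv ν ∈ L.ann := by
  obtain ⟨w₀, hw₀⟩ := hne
  set c : ℂ := ∏ l, w₀ (Sum.inr l) ^ ν l with hc
  have hc0 : c ≠ 0 := Finset.prod_ne_zero_iff.mpr fun l _ => zpow_ne_zero _ (hX hw₀ l)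
  have hval : ∀ z ∈ X, ∏ l, z (Sum.inr l) ^ ν l = c := fun z hz => by
    have h1 := h z hz w₀ hw₀
    rwa [prod_div_zpow (fun l => z (Sum.inr l)) (fun l => w₀ (Sum.inr l)) ν, div_eq_one_iff_eq hc0]
      at h1
  have hmem : ((∏ l, MvPolynomial.X (Sum.inr l) ^ (ν l).toNat) -
      C c * ∏ l, MvPolynomial.X (Sum.inr l) ^ (-ν l).toNat : MvPolynomial (Fin N' ⊕ Fin m) ℂ) ∈ L.P := by
    rw [hP, mem_vanishingIdeal_iff]
    intro z hz
    rw [aeval_binomial₂_eq_zero_iff (fun l => hX hz l) ν c, Algebra.algebraMap_self_apply]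
    exact hval z hz
  have hgen : ∏ l, L.y l ^ ν l = algebraMap ℂ L.F c := by
    have := (L.aeval_eq_zero_iff _).2 hmem
    exact (aeval_binomial₂_eq_zero_iff (v := Sum.elim L.u L.y) L.y_ne_zero ν c).1 this
  rw [qv_mem_ann_iff_prod]
  intro j
  rw [hgen, Derivation.map_algebraMap]

/-- Subspace form: if the ratios of `X` are killed by all integer points of `L'`, then
`L' ≤ ann(L)`. [folklore] -/
theorem le_ann_of_ratios (hX : X ⊆ torus₂ N' m) (hP : L.P = vanishingIdeal ℂ X) (hne : X.Nonempty)
    {L' : Submodule ℚ (Fin m → ℚ)}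
    (h : ∀ ν : Fin m → ℤ, qv ν ∈ L' → ∀ z ∈ X, ∀ w ∈ X,
      ∏ l, (z (Sum.inr l) / w (Sum.inr l)) ^ ν l = 1) : L' ≤ L.ann :=
  le_of_forall_qv_mem fun _ hν => qv_mem_ann_of_ratio_eq_one hX hP hne (h _ hν)

end LogPointG

end Ann

/-! ### Polynomial families of subvarieties of `𝔾ₐ^{N'} × 𝔾ₘ^m` -/

section Family

variable {N' m p : ℕ}

/-- The member `V_b = {w ∈ 𝔾ₐ^{N'} × 𝔾ₘ^m(ℂ) | φ(b, w) = 0 for φ ∈ Φ}` of the polynomial family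
defined by `Φ ⊆ ℂ[b, u, y]` at the parameter `b ∈ ℂ^p` (a constructible family of subvarieties, as
in the statement of the weak Zilber–Pink theorem). [cite: BaysKirby2018ANT, Fact 11.3 (`(W_b)_{b ∈ B}`)] -/
def famV (Φ : Finset (MvPolynomial (Fin p ⊕ (Fin N' ⊕ Fin m)) ℂ)) (b : Fin p → ℂ) :
    Set (Fin N' ⊕ Fin m → ℂ) :=
  {w | w ∈ torus₂ N' m ∧ ∀ φ ∈ Φ, aeval w (spec b φ) = 0}

variable {Φ : Finset (MvPolynomial (Fin p ⊕ (Fin N' ⊕ Fin m)) ℂ)} {b : Fin p → ℂ}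

/-- Membership in `V_b`. [folklore] -/
theorem mem_famV_iff {w : Fin N' ⊕ Fin m → ℂ} :
    w ∈ famV Φ b ↔ w ∈ torus₂ N' m ∧ ∀ φ ∈ Φ, aeval w (spec b φ) = 0 := Iff.rfl

/-- `V_b` lies in the torus part. [folklore] -/
theorem famV_subset_torus₂ : famV Φ b ⊆ torus₂ N' m := fun _ hw => hw.1

/-- Membership in `V_b` in terms of `φ(b, w)`. [folklore] -/
theorem mem_famV_iff' {w : Fin N' ⊕ Fin m → ℂ} :
    w ∈ famV Φ b ↔ w ∈ torus₂ N' m ∧ ∀ φ ∈ Φ, aeval (Sum.elim b w) φ = 0 := by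
  have : ∀ φ : MvPolynomial (Fin p ⊕ (Fin N' ⊕ Fin m)) ℂ,
      aeval w (spec b φ) = aeval (Sum.elim b w) φ := fun φ => by
    rw [aeval_spec]; rfl
  simp only [mem_famV_iff, this]

/-- **`Xc ∩ (𝔾ₐ^{N'} × 𝔾ₘ^m)` is dense in `Xc`** when `I(Xc)` is prime and the trace is non-empty.
[folklore] -/
theorem vanishingIdeal_inter_torus₂ {Xc : Set (Fin N' ⊕ Fin m → ℂ)}
    (hprime : (vanishingIdeal ℂ Xc).IsPrime) (hne : (Xc ∩ torus₂ N' m).Nonempty) :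
    vanishingIdeal ℂ (Xc ∩ torus₂ N' m) = vanishingIdeal ℂ Xc := by
  refine le_antisymm ?_ (vanishingIdeal_anti_mono inter_subset_left)
  intro a ha
  have h1 : a * ∏ i, X (Sum.inr i) ∈ vanishingIdeal ℂ Xc := by
    rw [mem_vanishingIdeal_iff]
    intro z hz
    by_cases hzT : z ∈ torus₂ N' m
    · rw [map_mul, (mem_vanishingIdeal_iff.1 ha) z ⟨hz, hzT⟩, zero_mul]
    · simp only [mem_torus₂_iff, not_forall, not_not] at hzT
      obtain ⟨i, hi⟩ := hzT
      rw [map_mul, map_prod]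
      simp only [aeval_X]
      rw [Finset.prod_eq_zero (Finset.mem_univ i) hi, mul_zero]
  have hprod : (∏ i, X (Sum.inr i) : MvPolynomial (Fin N' ⊕ Fin m) ℂ) ∉ vanishingIdeal ℂ Xc := by
    obtain ⟨z, hz, hzT⟩ := hne
    intro h
    have := (mem_vanishingIdeal_iff.1 h) z hz
    rw [map_prod] at this
    simp only [aeval_X] at this
    exact (Finset.prod_ne_zero_iff.2 fun i _ => hzT i) this
  exact (hprime.mem_or_mem h1).resolve_right hprod

/-- **The components of `V_b` through a point of the torus part have dimension `≤ dim V_b`**: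
for a prime `𝔮 ⊇ Φ(b, ·)` whose zero set meets the torus part,
`dim ℂ[u, y] ⧸ 𝔮 = dim Z(𝔮) = dim (Z(𝔮) ∩ G) ≤ dim V_b`. [folklore] -/
theorem ringKrullDim_quotient_le_zariskiDim_famV (𝔮 : Ideal (MvPolynomial (Fin N' ⊕ Fin m) ℂ))
    [𝔮.IsPrime] (hΦ : ∀ φ ∈ Φ, spec b φ ∈ 𝔮) (hne : (zeroLocus ℂ 𝔮 ∩ torus₂ N' m).Nonempty) :
    ringKrullDim (MvPolynomial (Fin N' ⊕ Fin m) ℂ ⧸ 𝔮) ≤ zariskiDim ℂ (famV Φ b) := by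
  have h1 : vanishingIdeal ℂ (zeroLocus ℂ 𝔮) = 𝔮 := MvPolynomial.IsPrime.vanishingIdeal_zeroLocus 𝔮
  have h2 : zariskiDim ℂ (zeroLocus ℂ 𝔮 ∩ torus₂ N' m) = zariskiDim ℂ (zeroLocus (K := ℂ) 𝔮) := by
    unfold zariskiDim
    rw [vanishingIdeal_inter_torus₂ (by rw [h1]; infer_instance) hne]
  have h3 : zeroLocus ℂ 𝔮 ∩ torus₂ N' m ⊆ famV Φ b := by
    rintro z ⟨hz, hzT⟩
    exact ⟨hzT, fun φ hφ => (mem_zeroLocus_iff.1 hz) _ (hΦ φ hφ)⟩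
  calc ringKrullDim (MvPolynomial (Fin N' ⊕ Fin m) ℂ ⧸ 𝔮)
        = zariskiDim ℂ (zeroLocus (K := ℂ) 𝔮) := by unfold zariskiDim; rw [h1]
    _ = zariskiDim ℂ (zeroLocus ℂ 𝔮 ∩ torus₂ N' m) := h2.symm
    _ ≤ zariskiDim ℂ (famV Φ b) := zariskiDim_mono h3

/-- `dim S ≤ #variables`. [folklore] -/
theorem zariskiDim_le_card {ι : Type} [Fintype ι] (S : Set (ι → ℂ)) :
    zariskiDim ℂ S ≤ Fintype.card ι := by
  unfold zariskiDim
  refine (ringKrullDim_quotient_le _).trans ?_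
  rw [MvPolynomial.ringKrullDim_of_isNoetherianRing, ringKrullDim_eq_zero_of_field,
    Nat.card_eq_fintype_card, zero_add]

/-- A non-empty `S ⊆ ℂ^ι` has a natural number dimension `≤ #ι`. [folklore] -/
theorem exists_nat_zariskiDim_eq {ι : Type} [Fintype ι] {S : Set (ι → ℂ)} (hS : S.Nonempty) :
    ∃ d : ℕ, zariskiDim ℂ S = d ∧ d ≤ Fintype.card ι :=
  WithBot.exists_nat_eq_of_le (zariskiDim_nonneg_of_nonempty hS) (zariskiDim_le_card S)

end Family

/-! ### Cosets, boxes of characters, and the main theorem -/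

section Main

variable {N' m p : ℕ}

/-- **`X` lies in a single coset of the subtorus `H_L`** (`L ≤ ℚ^m`): every character `y^ν`,
`ν ∈ ℤ^m ∩ L`, is constant on `X`, i.e. `∏ (zₗ/wₗ)^{νₗ} = 1` for `z, w ∈ X`.
[cite: BaysKirby2018ANT, §2.2 and Thm 11.4 (`X ⊆ U ⊕ (c' + H)`)] -/
def InCoset (X : Set (Fin N' ⊕ Fin m → ℂ)) (L : Submodule ℚ (Fin m → ℚ)) : Prop :=
  ∀ ν : Fin m → ℤ, qv ν ∈ L → ∀ z ∈ X, ∀ w ∈ X, ∏ l, (z (Sum.inr l) / w (Sum.inr l)) ^ ν l = 1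

/-- `InCoset` is inherited by subsets. [folklore] -/
theorem InCoset.mono {X Y : Set (Fin N' ⊕ Fin m → ℂ)} {L : Submodule ℚ (Fin m → ℚ)}
    (h : InCoset Y L) (hXY : X ⊆ Y) : InCoset X L :=
  fun ν hν z hz w hw => h ν hν z (hXY hz) w (hXY hw)

/-- `InCoset` is inherited by smaller subspaces (larger subtori). [folklore] -/
theorem InCoset.anti {X : Set (Fin N' ⊕ Fin m → ℂ)} {L L' : Submodule ℚ (Fin m → ℚ)}
    (h : InCoset X L) (hL : L' ≤ L) : InCoset X L' :=
  fun ν hν z hz w hw => h ν (hL hν) z hz w hw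

/-- `InCoset X L` for a logarithmic point `L₀` of `X` means `L ≤ ann(L₀)`. [folklore] -/
theorem inCoset_iff_le_ann {X : Set (Fin N' ⊕ Fin m → ℂ)} (hX : X ⊆ torus₂ N' m)
    {L₀ : LogPointG N' m} (hP : L₀.P = vanishingIdeal ℂ X) (hne : X.Nonempty)
    (L : Submodule ℚ (Fin m → ℚ)) : InCoset X L ↔ L ≤ L₀.ann :=
  ⟨fun h => LogPointG.le_ann_of_ratios hX hP hne h,
    fun h _ hν _ hz _ hw => LogPointG.ratio_eq_one_of_qv_mem_ann hX hP (h hν) hz hw⟩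

/-- The box `{q ∈ ℤ^m : |qₗ| ≤ k}`. [folklore] -/
def qBox (m k : ℕ) : Finset (Fin m → ℤ) := Fintype.piFinset fun _ => Finset.Icc (-(k : ℤ)) k

/-- Vectors with `|qₗ| ≤ k` lie in the box. [folklore] -/
theorem mem_qBox_of_natAbs_le {q : Fin m → ℤ} {k : ℕ} (h : ∀ l, (q l).natAbs ≤ k) :
    q ∈ qBox m k := by
  refine Fintype.mem_piFinset.2 fun l => Finset.mem_Icc.2 ?_
  have := h l
  omega

/-- **Rows of a unimodular matrix are a `ℤ`-basis**: if `rᵀ U` lies in the subgroup generated by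
the rows `U_i`, `i ∈ I`, and `r` vanishes on `I`, then `r = 0`. [folklore] -/
theorem eq_zero_of_vecMul_mem_closure {U U' : Matrix (Fin m) (Fin m) ℤ} (hUU' : U * U' = 1)
    {I : Finset (Fin m)} {r : Fin m → ℤ} (hrI : ∀ i ∈ I, r i = 0)
    (hmem : Matrix.vecMul r U ∈ AddSubgroup.closure ((fun i => U i) '' (I : Set (Fin m)))) :
    r = 0 := by
  classical
  rw [← Submodule.span_int_eq_addSubgroupClosure, Submodule.mem_toAddSubgroup] at hmem
  have hr : ((fun i => U i) '' (I : Set (Fin m))) = Set.range (fun i : (I : Set (Fin m)) => U i) := by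
    ext v; simp
  rw [hr, Submodule.mem_span_range_iff_exists_fun] at hmem
  obtain ⟨c, hc⟩ := hmem
  set r' : Fin m → ℤ := fun i => if h : i ∈ I then c ⟨i, h⟩ else 0 with hr'
  have hr'U : Matrix.vecMul r' U = Matrix.vecMul r U := by
    rw [← hc, Matrix.vecMul_eq_sum]
    have h1 : ∑ i, r' i • U i = ∑ i ∈ I, r' i • U i := by
      refine (Finset.sum_subset (Finset.subset_univ I) fun i _ hi => ?_).symm
      simp [hr', hi]
    rw [h1, ← Finset.sum_coe_sort I]
    refine Finset.sum_congr rfl fun i _ => ?_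
    simp [hr', i.2]
  have hdiff : r' - r = 0 := by
    have h1 : Matrix.vecMul (r' - r) U = 0 := by rw [Matrix.sub_vecMul, hr'U, sub_self]
    have h2 := congrArg (fun v => Matrix.vecMul v U') h1
    simp only [Matrix.vecMul_vecMul, hUU', Matrix.vecMul_one, Matrix.zero_vecMul] at h2
    exact h2
  have hrr' : r = r' := (sub_eq_zero.1 hdiff).symm
  funext i
  by_cases hi : i ∈ I
  · exact hrI i hi
  · rw [hrr']; simp [hr', hi]

/-- **Basic uniform horizontal weak Zilber–Pink relative to an ambient subtorus** (Bays–Kirby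
2018, Thm 11.4 for `U = 𝔾ₐ^{N'}`, `S = 𝔾ₘ^m`, relative to `H = H_{L_H}`, without the clause
`(*)`; Kirby 2009, Thm 4.6; Zilber 2002). See the module docstring.
[cite: BaysKirby2018ANT, Thm 11.4] [cite: Kirby2009, Thm 4.6] -/
theorem weakZP_basic_rel (Φ : Finset (MvPolynomial (Fin p ⊕ (Fin N' ⊕ Fin m)) ℂ))
    (LH : Submodule ℚ (Fin m → ℚ)) (hH : ∀ b, InCoset (famV Φ b) LH) :
    ∃ 𝓠 : Finset (Fin m → ℤ), (∀ q ∈ 𝓠, qv q ∉ LH) ∧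
      ∀ (b : Fin p → ℂ) (LJ : Submodule ℚ (Fin m → ℚ)) (X : Set (Fin N' ⊕ Fin m → ℂ)),
        X ⊆ famV Φ b → InCoset X LJ → X.Nonempty → (vanishingIdeal ℂ X).IsPrime →
        zariskiDim ℂ (famV Φ b) + ((m - Module.finrank ℚ ↥(LH ⊔ LJ) : ℕ) : WithBot ℕ∞) <
          zariskiDim ℂ X + ((m - Module.finrank ℚ LH : ℕ) : WithBot ℕ∞) →
        ∃ q ∈ 𝓠, InCoset X (LH ⊔ Submodule.span ℚ {qv q}) := by
  classical
  by_contra hcon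
  -- Step 0: for every `k`, a bad situation for `𝓠_k = {q ∈ qBox k | q ∉ L_H}`
  have hbad : ∀ k : ℕ, ∃ (b : Fin p → ℂ) (LJ : Submodule ℚ (Fin m → ℚ))
      (X : Set (Fin N' ⊕ Fin m → ℂ)), X ⊆ famV Φ b ∧ InCoset X LJ ∧ X.Nonempty ∧
      (vanishingIdeal ℂ X).IsPrime ∧
      zariskiDim ℂ (famV Φ b) + ((m - Module.finrank ℚ ↥(LH ⊔ LJ) : ℕ) : WithBot ℕ∞) <
          zariskiDim ℂ X + ((m - Module.finrank ℚ LH : ℕ) : WithBot ℕ∞) ∧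
      ∀ q ∈ (qBox m k).filter (fun q => qv q ∉ LH),
        ¬ InCoset X (LH ⊔ Submodule.span ℚ {qv q}) := by
    intro k
    by_contra h'
    push Not at h'
    apply hcon
    refine ⟨(qBox m k).filter (fun q => qv q ∉ LH), fun q hq => (Finset.mem_filter.1 hq).2, ?_⟩
    intro b LJ X hXV hXJ hne hprime hlt
    exact h' b LJ X hXV hXJ hne hprime hlt
  choose b LJ X hXV hXJ hne hprime hlt hnot using hbad
  have hXT : ∀ k, X k ⊆ torus₂ N' m := fun k => (hXV k).trans famV_subset_torus₂
  -- Step 1: `dim V_{b_k} = d_k ≤ N' + m`; pigeonhole on the value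
  have hd : ∀ k, ∃ d : ℕ, zariskiDim ℂ (famV Φ (b k)) = d ∧ d ≤ Fintype.card (Fin N' ⊕ Fin m) :=
    fun k => exists_nat_zariskiDim_eq ((hne k).mono (hXV k))
  choose dk hdk hdk_le using hd
  obtain ⟨d₀, hd₀⟩ : ∃ d₀ : ℕ, ∀ n : ℕ, ∃ k, n ≤ k ∧ dk k = d₀ := by
    by_contra h'
    push Not at h'
    choose nd hnd using h'
    set n : ℕ := (Finset.range (Fintype.card (Fin N' ⊕ Fin m) + 1)).sup nd with hn
    have hle : nd (dk n) ≤ n :=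
      Finset.le_sup (f := nd) (Finset.mem_range.2 (Nat.lt_succ_of_le (hdk_le n)))
    exact hnd (dk n) n hle rfl
  choose g hg_ge hg_d using hd₀
  -- Step 2: logarithmic points of the `X_{g n}`
  have hL : ∀ n, ∃ L : LogPointG N' m, L.P = vanishingIdeal ℂ (X (g n)) ∧
      (((L.Sy.card + L.Su.card : ℕ) : ℕ∞) : WithBot ℕ∞) = zariskiDim ℂ (X (g n)) :=
    fun n => exists_logPointG_of_isPrime (hXT _) (hne _) (hprime _)
  choose L hLP hLS using hL
  have hHann : ∀ n, LH ≤ (L n).ann := fun n =>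
    (inCoset_iff_le_ann (hXT _) (hLP n) (hne _) LH).1 ((hH (b (g n))).mono (hXV _))
  have hJann : ∀ n, LJ (g n) ≤ (L n).ann := fun n =>
    (inCoset_iff_le_ann (hXT _) (hLP n) (hne _) _).1 (hXJ (g n))
  -- Step 3: a unimodular basis adapted to `ℤ^m ∩ L_H`
  obtain ⟨UH, UH', IH, hUU', hU'U, hIH, hgenH⟩ :=
    WeakCIT.exists_unimodular (latt LH) (nsmulSaturated_latt LH)
  have hcardH : IH.card = Module.finrank ℚ LH := card_eq_finrank_of_unimodular hUU' hgenH
  have hHD : ∀ n, ∀ i ∈ IH, ∀ j, (L n).D j (∑ l, (UH i l : (L n).F) * (L n).x l) = 0 :=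
    fun n i hi => ((L n).qv_mem_ann_iff).1 (hHann n (hIH i hi))
  -- Step 4: unimodular bases adapted to `ℤ^m ∩ (L_H + L_{J_k})`
  have hVex : ∀ n, ∃ (V V' : Matrix (Fin m) (Fin m) ℤ) (J : Finset (Fin m)),
      V * V' = 1 ∧ V' * V = 1 ∧ (∀ i ∈ J, V i ∈ latt (LH ⊔ LJ (g n))) ∧
        latt (LH ⊔ LJ (g n)) = AddSubgroup.closure ((fun i => V i) '' (J : Set (Fin m))) :=
    fun n => WeakCIT.exists_unimodular _ (nsmulSaturated_latt _)
  choose V V' J hVV' hV'V hJmem hgenJ using hVex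
  have hcardJ : ∀ n, (J n).card = Module.finrank ℚ ↥(LH ⊔ LJ (g n)) := fun n =>
    card_eq_finrank_of_unimodular (hVV' n) (hgenJ n)
  have hJrel : ∀ n, ∀ i ∈ J n, ∀ j, (L n).D j (∑ l, (V n i l : (L n).F) * (L n).x l) = 0 :=
    fun n i hi => ((L n).qv_mem_ann_iff).1 (sup_le (hHann n) (hJann n) (hJmem n i hi))
  -- Step 5: the family hypotheses
  have hΦ : ∀ n, ∀ φ ∈ Φ, spec (b (g n)) φ ∈ (L n).P := by
    intro n φ hφ
    rw [hLP n, mem_vanishingIdeal_iff]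
    intro z hz
    exact (hXV (g n) hz).2 φ hφ
  have hdim : ∀ n, ∀ 𝔮 : Ideal (MvPolynomial (Fin N' ⊕ Fin m) ℂ), 𝔮.IsPrime → 𝔮 ≤ (L n).P →
      (∀ φ ∈ Φ, spec (b (g n)) φ ∈ 𝔮) →
        ringKrullDim (MvPolynomial (Fin N' ⊕ Fin m) ℂ ⧸ 𝔮) ≤ d₀ := by
    intro n 𝔮 h𝔮 hle hΦ𝔮
    haveI := h𝔮
    have hne' : (zeroLocus ℂ 𝔮 ∩ torus₂ N' m).Nonempty := by
      obtain ⟨z, hz⟩ := hne (g n)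
      refine ⟨z, ?_, hXT _ hz⟩
      have : z ∈ zeroLocus ℂ (vanishingIdeal ℂ (X (g n))) := zeroLocus_vanishingIdeal_le _ hz
      rw [← hLP n] at this
      exact zeroLocus_anti_mono hle this
    have := ringKrullDim_quotient_le_zariskiDim_famV (Φ := Φ) (b := b (g n)) 𝔮 hΦ𝔮 hne'
    rwa [hdk (g n), hg_d n] at this
  have hlt' : ∀ n, d₀ + IH.card < (L n).Sy.card + (L n).Su.card + (J n).card := by
    intro n
    have h1 := hlt (g n)
    rw [hdk (g n), hg_d n, ← hLS n] at h1
    rw [hcardH, hcardJ n]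
    have hρ : Module.finrank ℚ ↥(LH ⊔ LJ (g n)) ≤ m := finrank_le_m _
    have hh : Module.finrank ℚ LH ≤ Module.finrank ℚ ↥(LH ⊔ LJ (g n)) :=
      Submodule.finrank_mono le_sup_left
    have h2 : d₀ + (m - Module.finrank ℚ ↥(LH ⊔ LJ (g n))) <
        (L n).Sy.card + (L n).Su.card + (m - Module.finrank ℚ LH) := by
      have h3 : ((d₀ + (m - Module.finrank ℚ ↥(LH ⊔ LJ (g n))) : ℕ) : WithBot ℕ∞) <
          (((L n).Sy.card + (L n).Su.card + (m - Module.finrank ℚ LH) : ℕ) : WithBot ℕ∞) := by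
        push_cast at h1 ⊢
        exact h1
      exact_mod_cast h3
    omega
  -- Step 6: the compactness step
  obtain ⟨r, hr0, hrI, hrk⟩ := exists_int_relation_of_familyG L UH UH' hU'U IH hHD V V' hV'V J
    hJrel Φ (fun n => b (g n)) hΦ d₀ hdim hlt'
  set q : Fin m → ℤ := fun l => ∑ i, r i * UH i l with hq
  have hqU : q = Matrix.vecMul r UH := by
    funext l; simp [hq, Matrix.vecMul, dotProduct]
  -- `q ∉ L_H`
  have hqH : qv q ∉ LH := by
    intro hqL
    have hmem : Matrix.vecMul r UH ∈ AddSubgroup.closure ((fun i => UH i) '' (IH : Set (Fin m))) := by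
      rw [← hgenH, ← hqU]; exact hqL
    exact hr0 (eq_zero_of_vecMul_mem_closure hUU' hrI hmem)
  -- `q ∈ 𝓠_k` for `k ≥ K`
  set K : ℕ := Finset.univ.sup fun l => (q l).natAbs with hK
  have hqbox : ∀ k, K ≤ k → q ∈ (qBox m k).filter (fun q => qv q ∉ LH) := by
    intro k hk
    refine Finset.mem_filter.2 ⟨mem_qBox_of_natAbs_le fun l => ?_, hqH⟩
    exact (Finset.le_sup (f := fun l => (q l).natAbs) (Finset.mem_univ l)).trans hk
  -- Step 7: some `n ≥ K` with `y^q` killed by all derivations of `L_n`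
  obtain ⟨n, hKn, hDq⟩ := hrk K
  have hqann : qv q ∈ (L n).ann := ((L n).qv_mem_ann_iff_prod).2 hDq
  have hle : LH ⊔ Submodule.span ℚ {qv q} ≤ (L n).ann :=
    sup_le (hHann n) ((Submodule.span_singleton_le_iff_mem _ _).2 hqann)
  have hgood : InCoset (X (g n)) (LH ⊔ Submodule.span ℚ {qv q}) :=
    (inCoset_iff_le_ann (hXT _) (hLP n) (hne _) _).2 hle
  exact hnot (g n) q (hqbox (g n) (hKn.trans (hg_ge n))) hgood

end Main

end Literature.NumberTheory.Transcendental.WeakZP
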